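import Summits.Schanuel.Schanuel.Theorems.DiophantineDichotomyKhovanskiiApproxTypeEvDefs
import Summits.Schanuel.Schanuel.Theorems.DiophantineDichotomyApproximationRaceEv
import HarnessLib

/-!
# Route `DiophantineDichotomy`, crux `KhovanskiiApproxTypeEv`, line `anchored-reduction`:
# stub `stub_raceAnchored` — the eventual exponent race on the anchored family

Crux `Summit.Schanuel.Schanuel.Theses.DiophantineDichotomy.KhovanskiiApproxTypeEv`
(item stmt-Schanuel-14972), line `anchored-reduction` (skeleton of line lead
`prover-line-stmt-Schanuel-14972-0`), registered stub `stub_raceAnchored` (`--supports`):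
`ApproximationRaceEvAnchored`, i.e.
`ApproximationProperty → KhovanskiiApproxTypeEvAnchored → KhovanskiiSchanuelAnchored`.

Philippon's approximation property in transcendence degree `t` and the EVENTUAL-in-the-height
simultaneous approximation measure with degree exponent `a < 1/(n+1)` at an ANCHORED free
Khovanskii point `θ = (s, e^s) ∈ ℂ^{2(n+2)}`, `s = (1, iπ, s₂, …, s_{n+1})` `ℚ`-linearly
independent, give `trdeg_ℚ ℚ(s, e^s) ≥ n + 2`.  This is, pointwise, the `n ≥ 2` branch of the
route's deciding theorem `closes` / of `approximationRaceEv_proof`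
(`Theorems/DiophantineDichotomyApproximationRaceEv.lean`), whose elementary lemmas are reused.

## Proof (race compactness: FIX the scale `Δ`, let `Y → ∞`)

If `trdeg < n + 2` then `trdeg ≤ t := n + 1`; the approximation property at `θ` gives `c ≥ 1`, the
anchored crux gives `a < 1/(n+1)`, `b`, `C > 0` and thresholds `H₀ : ℕ → ℕ`.  THE RACE AT A FIXED
SCALE (`ApproximationRaceEv.race`): there are `Δ ≥ c`, `Y₁ ≥ Δ` such that for every `Y ≥ Y₁` no
`d ≥ 1`, `H ≥ 1` with `d ≤ (cΔ)^t` satisfies `Δ log H + dY ≤ cC(dᵃ log H + dᵇ)`.  LOW HEIGHTS CANNOT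
PERSIST: with `D₀ := ⌊(cΔ)^t⌋₊`, `H⋆ := max_{d ≤ D₀} H₀(d)`, the points all of whose coordinates are
roots of non-zero integer polynomials of degree `≤ D₀` and naive height `≤ H⋆` form a FINITE set `F`
(`ApproximationRaceEv.finite_roots`), and `θ ∉ F` since its coordinate `e^{s 0} = e` is
transcendental (Hermite–Lindemann, `transcendental_exp_holds`, at the algebraic anchor `s 0 = 1 ≠ 0`);
so a ball `B(θ, ε)` misses `F`.  For `Y ≥ Y₁` with `exp(−Y/c) < ε` the approximant `(γ, d, H)` at
scale `(Δ, Y)` has `1 ≤ d ≤ D₀`, `‖γ − θ‖ ≤ exp(−Y/c) < ε`, hence `γ ∉ F`, whence `H > H⋆ ≥ H₀(d)`: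
the eventual measure applies and gives `Δ log H + dY ≤ cC(dᵃ log H + dᵇ)` — contradiction.

No new definitions; inputs: Hermite–Lindemann (proved in the tree) and Mathlib.
-/

noncomputable section

-- `Summit.Schanuel.Schanuel.…` is the mandated summit/sub-problem namespace (single-conjunct summit), hence:
set_option linter.dupNamespace false

namespace Summit.Schanuel.Schanuel.Cruxes.KhovanskiiApproxTypeEv.AnchoredReduction

open Summit.Schanuel.Schanuel.Theses.DiophantineDichotomy (ApproximationProperty)
open Summit.Schanuel.Schanuel.Cruxes.KhovanskiiApproxType.LwSmallHeight (IsFreeKhovanskii)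
open Summit.Schanuel.Schanuel.Theorems

/-- **The eventual exponent race on the anchored family** (registered stub `stub_raceAnchored` of
line `anchored-reduction`, crux stmt-Schanuel-14972): Philippon's approximation property
(`ApproximationProperty`) and the eventual simultaneous-approximation measure with degree exponent
`a < 1/(n+1)` at every anchored free Khovanskii point `s = (1, iπ, s₂, …) ∈ ℂⁿ⁺²`
(`KhovanskiiApproxTypeEvAnchored`) give Schanuel at those points (`KhovanskiiSchanuelAnchored`):
race compactness — `ApproximationRaceEv.race` at ONE scale `Δ` with `Y → ∞`, the naive Northcott
finiteness `ApproximationRaceEv.finite_roots` forcing the heights of the approximants past every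
threshold `H₀(d)`, `d ≤ (cΔ)^{n+1}`; `θ = (s, e^s)` is not a low point because `e^{s 0} = e` is
transcendental. [folklore] -/
theorem stub_raceAnchored : ApproximationRaceEvAnchored := by
  intro hAP hEv n s h0 h1 hs hg
  by_contra hlt
  rw [not_le] at hlt
  -- `trdeg ≤ n + 1`, transported along `range (Sum.elim s (exp ∘ s)) = range s ∪ range (exp ∘ s)`
  -- (stated for a general set: the `ℚ`-algebra instance carries a proof depending on the set)
  have key : ∀ S : Set ℂ, S = Set.range s ∪ Set.range (Complex.exp ∘ s) →
      Algebra.trdeg ℚ ↥(IntermediateField.adjoin ℚ S) ≤ ((n + 1 : ℕ) : Cardinal) := by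
    rintro S rfl
    exact ApproximationRace.le_pred_of_lt_natCast (n := n + 2) (by omega) hlt
  set θ : Fin (n + 2) ⊕ Fin (n + 2) → ℂ := Sum.elim s (Complex.exp ∘ s) with hθ
  obtain ⟨c, hc1, hAP'⟩ :=
    hAP (Fin (n + 2) ⊕ Fin (n + 2)) θ (n + 1) (by omega) (key _ (Set.Sum.elim_range _ _))
  obtain ⟨a, b, C, ha, hC, hEv'⟩ := hEv n s h0 h1 hs hg
  choose H₀ hH₀ using hEv'
  have ha' : a < 1 / ((n + 1 : ℕ) : ℝ) := by
    have hcast : ((n + 2 : ℕ) : ℝ) - 1 = ((n + 1 : ℕ) : ℝ) := by push_cast; ring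
    rw [← hcast]
    exact ha
  have hcpos : (0 : ℝ) < c := lt_of_lt_of_le one_pos hc1
  -- the race at a fixed scale `Δ`
  obtain ⟨Δ, Y₁, hcΔ, hΔY₁, hrace⟩ :=
    ApproximationRaceEv.race (t := n + 1) (by omega) hc1 hC ha'
  have hΔpos : 0 < Δ := lt_of_lt_of_le hcpos hcΔ
  -- the degree budget and the height threshold at this scale
  set D₀ : ℕ := ⌊(c * Δ) ^ (n + 1)⌋₊ with hD₀
  set Hs : ℕ := (Finset.range (D₀ + 1)).sup H₀ with hHs
  -- the finite set of low points
  set R : Set ℂ := {z : ℂ | ∃ P : Polynomial ℤ, P ≠ 0 ∧ P.natDegree ≤ D₀ ∧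
    (∀ k, |P.coeff k| ≤ (Hs : ℤ)) ∧ Polynomial.aeval z P = 0} with hR
  set F : Set (Fin (n + 2) ⊕ Fin (n + 2) → ℂ) := Set.pi Set.univ (fun _ => R) with hF
  have hFfin : F.Finite := Set.Finite.pi (fun _ => ApproximationRaceEv.finite_roots D₀ Hs)
  -- `θ ∉ F`: the coordinate `e^{s 0} = e` of `θ` is transcendental (Hermite–Lindemann at `1`)
  have hθF : θ ∉ F := by
    have hs0 : s 0 ≠ 0 := hs.ne_zero 0
    have halg : IsAlgebraic ℚ (s 0) := by rw [h0]; exact isAlgebraic_one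
    have htr : Transcendental ℚ (θ (Sum.inr 0)) :=
      Literature.NumberTheory.Transcendental.transcendental_exp_holds halg hs0
    intro hmem
    obtain ⟨P, hP0, -, -, hz⟩ := hmem (Sum.inr 0) (Set.mem_univ _)
    exact htr (ApproximationRaceEv.isAlgebraic_of_root hP0 hz)
  -- a ball around `θ` missing `F`
  obtain ⟨ε, hε, hball⟩ := Metric.isOpen_iff.mp hFfin.isClosed.isOpen_compl θ hθF
  -- a large second scale `Y`
  have hevY : ∀ᶠ Y in Filter.atTop, Y₁ ≤ Y ∧ Real.exp (-(Y / c)) < ε := by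
    refine (Filter.eventually_ge_atTop Y₁).and ?_
    have h1 : Filter.Tendsto (fun Y : ℝ => -(Y / c)) Filter.atTop Filter.atBot :=
      Filter.tendsto_neg_atTop_atBot.comp (Filter.tendsto_id.atTop_div_const hcpos)
    exact (Real.tendsto_exp_atBot.comp h1).eventually (gt_mem_nhds hε)
  obtain ⟨Y, hY₁Y, hYε⟩ := hevY.exists
  have hΔY : Δ ≤ Y := hΔY₁.trans hY₁Y
  -- the approximant at scale `(Δ, Y)`
  obtain ⟨γ, d, H, hfin, hpoly, hd, -, hdist⟩ := hAP' Δ Y hcΔ hΔY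
  obtain ⟨P, hP0, hPdeg, hPH, hPz⟩ := hpoly (Sum.inl 0)
  have h1d : 1 ≤ d := ApproximationRace.one_le_of_root hP0 hPdeg hPz
  have h1H : 1 ≤ H := ApproximationRace.one_le_height hP0 hPH
  have hd1 : (1 : ℝ) ≤ d := by exact_mod_cast h1d
  have hH1 : (1 : ℝ) ≤ H := by exact_mod_cast h1H
  have hL : 0 ≤ Real.log H := Real.log_nonneg hH1
  have hdD₀ : d ≤ D₀ := Nat.le_floor hd
  -- `‖γ - θ‖ < ε`, so `γ ∉ F`
  have hγθ : ‖γ - θ‖ < ε := by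
    refine lt_of_le_of_lt (hdist.trans (Real.exp_le_exp.mpr ?_)) hYε
    rw [neg_le_neg_iff, div_le_div_iff_of_pos_right hcpos]
    have hY0 : 0 ≤ Y := hΔpos.le.trans hΔY
    nlinarith [mul_nonneg hL hΔpos.le]
  have hγF : γ ∉ F := by
    refine hball ?_
    rw [Metric.mem_ball, dist_eq_norm]
    exact hγθ
  -- hence the height is past the threshold
  have hHsH : Hs < H := by
    by_contra hle'
    rw [not_lt] at hle'
    refine hγF fun i _ => ?_
    obtain ⟨Q, hQ0, hQdeg, hQH, hQz⟩ := hpoly i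
    refine ⟨Q, hQ0, hQdeg.trans hdD₀, fun k => (hQH k).trans ?_, hQz⟩
    exact_mod_cast hle'
  have hH₀H : H₀ d ≤ H := by
    have : H₀ d ≤ Hs := Finset.le_sup (f := H₀) (Finset.mem_range.mpr (Nat.lt_succ_of_le hdD₀))
    omega
  -- the eventual measure applies
  have hlow := hH₀ d H γ hH₀H hfin hpoly
  have hsand := Real.exp_le_exp.mp (hlow.trans hdist)
  have hineq : Real.log H * Δ + d * Y ≤ c * (C * ((d : ℝ) ^ a * Real.log H + (d : ℝ) ^ b)) := by
    have := neg_le_neg hsand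
    rw [neg_neg, neg_neg, div_le_iff₀ hcpos] at this
    linarith
  exact absurd hineq (not_le.mpr (hrace Y hY₁Y d H h1d h1H hd))

end Summit.Schanuel.Schanuel.Cruxes.KhovanskiiApproxTypeEv.AnchoredReduction

end
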